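import Mathlib
import Summits.Ventures.PercRepro.TriangleCapRowJTable

/-!
# PercRepro — THE ROWS `r = a + j` WITH `a ≤ j + 4`: THE ARITHMETIC OF THE MIXED READS AT `d ≥ 3` AGAINST THE
ONE-TRIANGLE TARGET (p3, gen 49; part 203c)

The `a`-bipartite `D − z` has `s = d + j` missing pairs, `x` of them at an off-side neighbour `w₀` of `z`
(`x ≥ t − 1`, `t` the in-side neighbours of `z`, `s₀ = d − t` the off-side ones). Two reads of the pair count of the
missing graph:
* the plain vertex bound at `w₀` (`Σh² + 2 (s − x)(x − 1) ≤ s (s + 1)`, part 201g) with `T ≤ t (k − a − 2) + (a − x) +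
  (s₀ − 1)(a + 1 − t)` (`s₀ = 1`) or `T ≤ t (k − a − s₀) + (a − x) + (s₀ − 1)(a + 1 − t)` (`s₀ ≥ 2`), read at
  `x = t` (`rowT_one_t`, `rowT_two_t`) and at `x = min (s, a)` (`rowT_one_hi_s` / `rowT_one_hi_a`, `rowT_two_hi_s` /
  `rowT_two_hi_a`) — by the convexity of the read in `x` these cover every `x ≥ t`;
* at `x = t − 1` the vertex bound with the leaf term explicit (part 203a), whose leaf term is cancelled against
  the degrees of the in-side neighbours of `z` (`w₀` then misses exactly `t − 1` of them, part 203d):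
  `Σh² + 2x (s − x)` against `T ≤ t (k − a − 2) + (a − x) + (s₀ − 1)(a + 1 − t)` (`rowT_one_lo`, `rowT_two_lo`).
In the regime `a ≤ j + 4` the plain read at `x = t − 1` is up to `2j s₀` short of the target (the configuration it
charges for — a star at a leaf of `w₀` — puts the star at an in-side neighbour of `z`, whose missing degree is
penalised in `T`); the refined read closes with slack `≥ 4`. Every slack is an explicit polynomial with non-negative
value on the range (mining/p3/g49 slackT.py, readsT2.py). Axioms: standard.
-/

namespace PercRepro

namespace TriangleCap

namespace C047

/-- Single off-side neighbour, `x = t − 1 = d − 2`, the refined read: slack `2uv + 4v + 2u + 6`. -/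
theorem rowT_one_lo (a j d x k m' S' T : ℕ) (hk : 3 * a + j ≤ k) (hd3 : 3 ≤ d) (hda : d + 1 ≤ a)
    (hx : x + 2 = d) (hmd : m' + d + (a + j) = a * (k - a))
    (hST : S' + 2 * T + (d + j) * (k - 1 - 1 - (d + j)) + (2 * (x * (d + j - x)) + 2 * x) ≤
      m' * (k - 1) + 2 * ((d - 1) * (k - a - 2)) + 2 * a) :
    S' + 2 * T + d + d * d + (a + j) * (k - 1 - (a + j)) + (2 * k - 14 + 2 * j * (a - 3)) ≤ (m' + d) * k := by
  obtain ⟨v, rfl⟩ : ∃ v, d = v + 3 := ⟨d - 3, by omega⟩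
  have hxv : x = v + 1 := by omega
  subst hxv
  obtain ⟨u, rfl⟩ : ∃ u, a = v + 3 + 1 + u := ⟨a - (v + 3 + 1), by omega⟩
  have h2 : 1 ≤ k := by omega
  have h3 : 1 ≤ k - 1 := by omega
  have h4 : v + 3 + j ≤ k - 1 - 1 := by omega
  have h5 : v + 1 ≤ v + 3 + j := by omega
  have h6 : 1 ≤ v + 3 := by omega
  have h7 : v + 3 + 1 + u ≤ k := by omega
  have h8 : 2 ≤ k - (v + 3 + 1 + u) := by omega
  have h9 : v + 3 + 1 + u + j ≤ k - 1 := by omega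
  have h10 : 14 ≤ 2 * k := by omega
  have h11 : 3 ≤ v + 3 + 1 + u := by omega
  zify [h2, h3, h4, h5, h6, h7, h8, h9, h10, h11] at hST hmd ⊢
  linarith [hST, hmd, Nat.zero_le (u * v)]

/-- Single off-side neighbour, `x = t = d − 1`, the plain read: slack `2uv + 4v + 2u + 10`. -/
theorem rowT_one_t (a j d x k m' S' T : ℕ) (hk : 3 * a + j ≤ k) (hd3 : 3 ≤ d) (hda : d + 1 ≤ a)
    (hx : x + 1 = d) (hmd : m' + d + (a + j) = a * (k - a))
    (hST : S' + 2 * T + (d + j) * (k - 1 - 1 - (d + j)) + (2 * ((d + j - x) * (x - 1)) + 2 * x) ≤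
      m' * (k - 1) + 2 * ((d - 1) * (k - a - 2)) + 2 * a) :
    S' + 2 * T + d + d * d + (a + j) * (k - 1 - (a + j)) + (2 * k - 14 + 2 * j * (a - 3)) ≤ (m' + d) * k := by
  obtain ⟨v, rfl⟩ : ∃ v, d = v + 3 := ⟨d - 3, by omega⟩
  have hxv : x = v + 2 := by omega
  subst hxv
  obtain ⟨u, rfl⟩ : ∃ u, a = v + 3 + 1 + u := ⟨a - (v + 3 + 1), by omega⟩
  have h2 : 1 ≤ k := by omega
  have h3 : 1 ≤ k - 1 := by omega
  have h4 : v + 3 + j ≤ k - 1 - 1 := by omega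
  have h5 : v + 2 ≤ v + 3 + j := by omega
  have h5' : 1 ≤ v + 2 := by omega
  have h6 : 1 ≤ v + 3 := by omega
  have h7 : v + 3 + 1 + u ≤ k := by omega
  have h8 : 2 ≤ k - (v + 3 + 1 + u) := by omega
  have h9 : v + 3 + 1 + u + j ≤ k - 1 := by omega
  have h10 : 14 ≤ 2 * k := by omega
  have h11 : 3 ≤ v + 3 + 1 + u := by omega
  zify [h2, h3, h4, h5, h5', h6, h7, h8, h9, h10, h11] at hST hmd ⊢
  linarith [hST, hmd, Nat.zero_le (u * v)]

/-- Single off-side neighbour, `x = s = d + j ≤ a`, the plain read (`a ≤ j + 4`): slack `2vw + 2w − 2v + 2j + 4`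
with `v + w ≤ 1`. -/
theorem rowT_one_hi_s (a j d x k m' S' T : ℕ) (haj : a ≤ j + 4) (hk : 3 * a + j ≤ k) (hd3 : 3 ≤ d)
    (hda : d + 1 ≤ a) (hsa : d + j ≤ a) (hx : x = d + j) (hmd : m' + d + (a + j) = a * (k - a))
    (hST : S' + 2 * T + (d + j) * (k - 1 - 1 - (d + j)) + (2 * ((d + j - x) * (x - 1)) + 2 * x) ≤
      m' * (k - 1) + 2 * ((d - 1) * (k - a - 2)) + 2 * a) :
    S' + 2 * T + d + d * d + (a + j) * (k - 1 - (a + j)) + (2 * k - 14 + 2 * j * (a - 3)) ≤ (m' + d) * k := by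
  subst hx
  rw [Nat.sub_self, zero_mul, mul_zero, zero_add] at hST
  obtain ⟨v, rfl⟩ : ∃ v, d = v + 3 := ⟨d - 3, by omega⟩
  obtain ⟨w, rfl⟩ : ∃ w, a = v + 3 + j + w := ⟨a - (v + 3 + j), by omega⟩
  have hvw : v + w ≤ 1 := by omega
  have h2 : 1 ≤ k := by omega
  have h3 : 1 ≤ k - 1 := by omega
  have h4 : v + 3 + j ≤ k - 1 - 1 := by omega
  have h5 : 1 ≤ v + 3 + j := by omega
  have h6 : 1 ≤ v + 3 := by omega
  have h7 : v + 3 + j + w ≤ k := by omega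
  have h8 : 2 ≤ k - (v + 3 + j + w) := by omega
  have h9 : v + 3 + j + w + j ≤ k - 1 := by omega
  have h10 : 14 ≤ 2 * k := by omega
  have h11 : 3 ≤ v + 3 + j + w := by omega
  zify [h2, h3, h4, h5, h6, h7, h8, h9, h10, h11] at hST hmd ⊢
  linarith [hST, hmd, hvw, Nat.zero_le (v * w)]

/-- Single off-side neighbour, `x = a ≤ s = d + j`, the plain read (`a ≤ j + 4`): slack `2uw + 2w − 2v + 4u + 6`
with `v ≤ u + 1`. -/
theorem rowT_one_hi_a (a j d x k m' S' T : ℕ) (haj : a ≤ j + 4) (hk : 3 * a + j ≤ k) (hd3 : 3 ≤ d)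
    (hda : d + 1 ≤ a) (has : a ≤ d + j) (hx : x = a) (hmd : m' + d + (a + j) = a * (k - a))
    (hST : S' + 2 * T + (d + j) * (k - 1 - 1 - (d + j)) + (2 * ((d + j - x) * (x - 1)) + 2 * x) ≤
      m' * (k - 1) + 2 * ((d - 1) * (k - a - 2)) + 2 * a) :
    S' + 2 * T + d + d * d + (a + j) * (k - 1 - (a + j)) + (2 * k - 14 + 2 * j * (a - 3)) ≤ (m' + d) * k := by
  subst hx
  obtain ⟨v, rfl⟩ : ∃ v, d = v + 3 := ⟨d - 3, by omega⟩
  obtain ⟨w, rfl⟩ : ∃ w, x = v + 3 + 1 + w := ⟨x - (v + 3 + 1), by omega⟩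
  obtain ⟨u, rfl⟩ : ∃ u, j = w + 1 + u := ⟨j - (w + 1), by omega⟩
  have hvu : v ≤ u + 1 := by omega
  have h2 : 1 ≤ k := by omega
  have h3 : 1 ≤ k - 1 := by omega
  have h4 : v + 3 + (w + 1 + u) ≤ k - 1 - 1 := by omega
  have h5 : v + 3 + 1 + w ≤ v + 3 + (w + 1 + u) := by omega
  have h5' : 1 ≤ v + 3 + 1 + w := by omega
  have h6 : 1 ≤ v + 3 := by omega
  have h7 : v + 3 + 1 + w ≤ k := by omega
  have h8 : 2 ≤ k - (v + 3 + 1 + w) := by omega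
  have h9 : v + 3 + 1 + w + (w + 1 + u) ≤ k - 1 := by omega
  have h10 : 14 ≤ 2 * k := by omega
  have h11 : 3 ≤ v + 3 + 1 + w := by omega
  zify [h2, h3, h4, h5, h5', h6, h7, h8, h9, h10, h11] at hST hmd ⊢
  linarith [hST, hmd, hvu, Nat.zero_le (u * w)]

/-- `s₀ ≥ 2` off-side neighbours, `x = t − 1`, the refined read. -/
theorem rowT_two_lo (a j d t s₀ x k m' S' T : ℕ) (hk : 3 * a + j ≤ k) (hd3 : 3 ≤ d) (hda : d + 1 ≤ a)
    (hts : t + s₀ = d) (ht1 : 1 ≤ t) (hs₀ : 2 ≤ s₀) (hx : x + 1 = t)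
    (hmd : m' + d + (a + j) = a * (k - a))
    (hST : S' + 2 * T + (d + j) * (k - 1 - 1 - (d + j)) + (2 * (x * (d + j - x)) + 2 * x) ≤
      m' * (k - 1) + 2 * (t * (k - a - 2)) + 2 * a + 2 * ((s₀ - 1) * (a + 1 - t))) :
    S' + 2 * T + d + d * d + (a + j) * (k - 1 - (a + j)) + (2 * k - 14 + 2 * j * (a - 3)) ≤ (m' + d) * k := by
  subst hts
  obtain ⟨e, rfl⟩ : ∃ e, s₀ = e + 2 := ⟨s₀ - 2, by omega⟩
  obtain ⟨v, rfl⟩ : ∃ v, t = v + 1 := ⟨t - 1, by omega⟩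
  rw [show x = v by omega] at hST
  obtain ⟨u, rfl⟩ : ∃ u, a = v + 1 + (e + 2) + 1 + u := ⟨a - (v + 1 + (e + 2) + 1), by omega⟩
  obtain ⟨c, rfl⟩ : ∃ c, k = 3 * (v + 1 + (e + 2) + 1 + u) + j + c :=
    ⟨k - (3 * (v + 1 + (e + 2) + 1 + u) + j), by omega⟩
  have h2 : 1 ≤ 3 * (v + 1 + (e + 2) + 1 + u) + j + c := by omega
  have h3 : 1 ≤ 3 * (v + 1 + (e + 2) + 1 + u) + j + c - 1 := by omega
  have h4 : v + 1 + (e + 2) + j ≤ 3 * (v + 1 + (e + 2) + 1 + u) + j + c - 1 - 1 := by omega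
  have h5 : v ≤ v + 1 + (e + 2) + j := by omega
  have h7 : v + 1 + (e + 2) + 1 + u ≤ 3 * (v + 1 + (e + 2) + 1 + u) + j + c := by omega
  have h8 : 2 ≤ 3 * (v + 1 + (e + 2) + 1 + u) + j + c - (v + 1 + (e + 2) + 1 + u) := by omega
  have h9 : v + 1 + (e + 2) + 1 + u + j ≤ 3 * (v + 1 + (e + 2) + 1 + u) + j + c - 1 := by omega
  have h10 : 14 ≤ 2 * (3 * (v + 1 + (e + 2) + 1 + u) + j + c) := by omega
  have h11 : 3 ≤ v + 1 + (e + 2) + 1 + u := by omega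
  have h12 : 1 ≤ e + 2 := by omega
  have h13 : v + 1 ≤ v + 1 + (e + 2) + 1 + u + 1 := by omega
  zify [h2, h3, h4, h5, h7, h8, h9, h10, h11, h12, h13] at hST hmd ⊢
  linarith [hST, hmd, Nat.zero_le (e * e), Nat.zero_le (v * e), Nat.zero_le (u * e), Nat.zero_le (u * v),
    Nat.zero_le (c * e)]

/-- `s₀ ≥ 2` off-side neighbours, `x = t`, the plain read. -/
theorem rowT_two_t (a j d t s₀ x k m' S' T : ℕ) (hk : 3 * a + j ≤ k) (hd3 : 3 ≤ d) (hda : d + 1 ≤ a)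
    (hts : t + s₀ = d) (ht1 : 1 ≤ t) (hs₀ : 2 ≤ s₀) (hx : x = t)
    (hmd : m' + d + (a + j) = a * (k - a))
    (hST : S' + 2 * T + (d + j) * (k - 1 - 1 - (d + j)) + (2 * ((d + j - x) * (x - 1)) + 2 * x) ≤
      m' * (k - 1) + 2 * (t * (k - a - s₀)) + 2 * a + 2 * ((s₀ - 1) * (a + 1 - t))) :
    S' + 2 * T + d + d * d + (a + j) * (k - 1 - (a + j)) + (2 * k - 14 + 2 * j * (a - 3)) ≤ (m' + d) * k := by
  subst hts
  rw [hx] at hST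
  obtain ⟨e, rfl⟩ : ∃ e, s₀ = e + 2 := ⟨s₀ - 2, by omega⟩
  obtain ⟨v, rfl⟩ : ∃ v, t = v + 1 := ⟨t - 1, by omega⟩
  obtain ⟨u, rfl⟩ : ∃ u, a = v + 1 + (e + 2) + 1 + u := ⟨a - (v + 1 + (e + 2) + 1), by omega⟩
  obtain ⟨c, rfl⟩ : ∃ c, k = 3 * (v + 1 + (e + 2) + 1 + u) + j + c :=
    ⟨k - (3 * (v + 1 + (e + 2) + 1 + u) + j), by omega⟩
  have h2 : 1 ≤ 3 * (v + 1 + (e + 2) + 1 + u) + j + c := by omega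
  have h3 : 1 ≤ 3 * (v + 1 + (e + 2) + 1 + u) + j + c - 1 := by omega
  have h4 : v + 1 + (e + 2) + j ≤ 3 * (v + 1 + (e + 2) + 1 + u) + j + c - 1 - 1 := by omega
  have h5 : v + 1 ≤ v + 1 + (e + 2) + j := by omega
  have h5' : 1 ≤ v + 1 := by omega
  have h7 : v + 1 + (e + 2) + 1 + u ≤ 3 * (v + 1 + (e + 2) + 1 + u) + j + c := by omega
  have h8 : e + 2 ≤ 3 * (v + 1 + (e + 2) + 1 + u) + j + c - (v + 1 + (e + 2) + 1 + u) := by omega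
  have h9 : v + 1 + (e + 2) + 1 + u + j ≤ 3 * (v + 1 + (e + 2) + 1 + u) + j + c - 1 := by omega
  have h10 : 14 ≤ 2 * (3 * (v + 1 + (e + 2) + 1 + u) + j + c) := by omega
  have h11 : 3 ≤ v + 1 + (e + 2) + 1 + u := by omega
  have h12 : 1 ≤ e + 2 := by omega
  have h13 : v + 1 ≤ v + 1 + (e + 2) + 1 + u + 1 := by omega
  zify [h2, h3, h4, h5, h5', h7, h8, h9, h10, h11, h12, h13] at hST hmd ⊢
  linarith [hST, hmd, Nat.zero_le (e * e), Nat.zero_le (v * e), Nat.zero_le (u * e), Nat.zero_le (u * v),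
    Nat.zero_le (c * e)]

/-- `s₀ ≥ 2` off-side neighbours, `x = s = d + j ≤ a`, the plain read. -/
theorem rowT_two_hi_s (a j d t s₀ x k m' S' T : ℕ) (hk : 3 * a + j ≤ k) (hd3 : 3 ≤ d) (hda : d + 1 ≤ a)
    (hts : t + s₀ = d) (ht1 : 1 ≤ t) (hs₀ : 2 ≤ s₀) (hsa : d + j ≤ a) (hx : x = d + j)
    (hmd : m' + d + (a + j) = a * (k - a))
    (hST : S' + 2 * T + (d + j) * (k - 1 - 1 - (d + j)) + (2 * ((d + j - x) * (x - 1)) + 2 * x) ≤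
      m' * (k - 1) + 2 * (t * (k - a - s₀)) + 2 * a + 2 * ((s₀ - 1) * (a + 1 - t))) :
    S' + 2 * T + d + d * d + (a + j) * (k - 1 - (a + j)) + (2 * k - 14 + 2 * j * (a - 3)) ≤ (m' + d) * k := by
  subst hts
  rw [hx, Nat.sub_self, zero_mul, mul_zero, zero_add] at hST
  obtain ⟨e, rfl⟩ : ∃ e, s₀ = e + 2 := ⟨s₀ - 2, by omega⟩
  obtain ⟨v, rfl⟩ : ∃ v, t = v + 1 := ⟨t - 1, by omega⟩
  obtain ⟨u, rfl⟩ : ∃ u, a = v + 1 + (e + 2) + j + u := ⟨a - (v + 1 + (e + 2) + j), by omega⟩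
  obtain ⟨c, rfl⟩ : ∃ c, k = 3 * (v + 1 + (e + 2) + j + u) + j + c :=
    ⟨k - (3 * (v + 1 + (e + 2) + j + u) + j), by omega⟩
  have h2 : 1 ≤ 3 * (v + 1 + (e + 2) + j + u) + j + c := by omega
  have h3 : 1 ≤ 3 * (v + 1 + (e + 2) + j + u) + j + c - 1 := by omega
  have h4 : v + 1 + (e + 2) + j ≤ 3 * (v + 1 + (e + 2) + j + u) + j + c - 1 - 1 := by omega
  have h5' : 1 ≤ v + 1 + (e + 2) + j := by omega
  have h7 : v + 1 + (e + 2) + j + u ≤ 3 * (v + 1 + (e + 2) + j + u) + j + c := by omega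
  have h8 : e + 2 ≤ 3 * (v + 1 + (e + 2) + j + u) + j + c - (v + 1 + (e + 2) + j + u) := by omega
  have h9 : v + 1 + (e + 2) + j + u + j ≤ 3 * (v + 1 + (e + 2) + j + u) + j + c - 1 := by omega
  have h10 : 14 ≤ 2 * (3 * (v + 1 + (e + 2) + j + u) + j + c) := by omega
  have h11 : 3 ≤ v + 1 + (e + 2) + j + u := by omega
  have h12 : 1 ≤ e + 2 := by omega
  have h13 : v + 1 ≤ v + 1 + (e + 2) + j + u + 1 := by omega
  zify [h2, h3, h4, h5', h7, h8, h9, h10, h11, h12, h13] at hST hmd ⊢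
  linarith [hST, hmd, Nat.zero_le (e * e), Nat.zero_le (u * e), Nat.zero_le (v * e), Nat.zero_le (v * u),
    Nat.zero_le (c * e), Nat.zero_le (j * e)]

/-- `s₀ ≥ 2` off-side neighbours, `x = a ≤ s = d + j`, the plain read. -/
theorem rowT_two_hi_a (a j d t s₀ x k m' S' T : ℕ) (hk : 3 * a + j ≤ k) (hd3 : 3 ≤ d) (hda : d + 1 ≤ a)
    (hts : t + s₀ = d) (ht1 : 1 ≤ t) (hs₀ : 2 ≤ s₀) (has : a ≤ d + j) (hx : x = a)
    (hmd : m' + d + (a + j) = a * (k - a))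
    (hST : S' + 2 * T + (d + j) * (k - 1 - 1 - (d + j)) + (2 * ((d + j - x) * (x - 1)) + 2 * x) ≤
      m' * (k - 1) + 2 * (t * (k - a - s₀)) + 2 * a + 2 * ((s₀ - 1) * (a + 1 - t))) :
    S' + 2 * T + d + d * d + (a + j) * (k - 1 - (a + j)) + (2 * k - 14 + 2 * j * (a - 3)) ≤ (m' + d) * k := by
  subst hts
  rw [hx] at hST
  obtain ⟨e, rfl⟩ : ∃ e, s₀ = e + 2 := ⟨s₀ - 2, by omega⟩
  obtain ⟨v, rfl⟩ : ∃ v, t = v + 1 := ⟨t - 1, by omega⟩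
  obtain ⟨w, rfl⟩ : ∃ w, a = v + 1 + (e + 2) + 1 + w := ⟨x - (v + 1 + (e + 2) + 1), by omega⟩
  obtain ⟨u, rfl⟩ : ∃ u, j = w + 1 + u := ⟨j - (w + 1), by omega⟩
  obtain ⟨c, rfl⟩ : ∃ c, k = 3 * (v + 1 + (e + 2) + 1 + w) + (w + 1 + u) + c :=
    ⟨k - (3 * (v + 1 + (e + 2) + 1 + w) + (w + 1 + u)), by omega⟩
  have h2 : 1 ≤ 3 * (v + 1 + (e + 2) + 1 + w) + (w + 1 + u) + c := by omega
  have h3 : 1 ≤ 3 * (v + 1 + (e + 2) + 1 + w) + (w + 1 + u) + c - 1 := by omega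
  have h4 : v + 1 + (e + 2) + (w + 1 + u) ≤ 3 * (v + 1 + (e + 2) + 1 + w) + (w + 1 + u) + c - 1 - 1 := by omega
  have h5 : v + 1 + (e + 2) + 1 + w ≤ v + 1 + (e + 2) + (w + 1 + u) := by omega
  have h5' : 1 ≤ v + 1 + (e + 2) + 1 + w := by omega
  have h7 : v + 1 + (e + 2) + 1 + w ≤ 3 * (v + 1 + (e + 2) + 1 + w) + (w + 1 + u) + c := by omega
  have h8 : e + 2 ≤ 3 * (v + 1 + (e + 2) + 1 + w) + (w + 1 + u) + c - (v + 1 + (e + 2) + 1 + w) := by omega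
  have h9 : v + 1 + (e + 2) + 1 + w + (w + 1 + u) ≤ 3 * (v + 1 + (e + 2) + 1 + w) + (w + 1 + u) + c - 1 := by
    omega
  have h10 : 14 ≤ 2 * (3 * (v + 1 + (e + 2) + 1 + w) + (w + 1 + u) + c) := by omega
  have h11 : 3 ≤ v + 1 + (e + 2) + 1 + w := by omega
  have h12 : 1 ≤ e + 2 := by omega
  have h13 : v + 1 ≤ v + 1 + (e + 2) + 1 + w + 1 := by omega
  zify [h2, h3, h4, h5, h5', h7, h8, h9, h10, h11, h12, h13] at hST hmd ⊢
  linarith [hST, hmd, Nat.zero_le (e * e), Nat.zero_le (w * e), Nat.zero_le (v * e), Nat.zero_le (u * e),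
    Nat.zero_le (u * w), Nat.zero_le (c * e)]

end C047

end TriangleCap

end PercRepro
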